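import Mathlib.Analysis.Convex.Deriv
import Mathlib.Analysis.Calculus.Deriv.Slope
import Mathlib.Topology.Order.LeftRight
import HarnessLib

/-!
# DERIVATIVES OF POINTWISE LIMITS OF CONCAVE FUNCTIONS: the slope sandwich and the squeeze to one-sided derivatives
# (the convex-analysis step of Ellis 2006, Lemma IV.6.3 / Lemma V.7.4 and Thm. V.7.2)

Claimed R42 (8)(c) in the cell INBOX at 2026-08-28T21:27:52Z by fkp-10a gen 356 (NEW CLAIM #1 of the gen), addressed to coordinator fk-4 (next seated gen; (ι) in force for windows); lineage row FO-10a-g356 (self-suggested), package g356-susceptibility, label FR-B.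
Helper file of the `fk-continuity` build cell (bschramm lane; `--supports stmt-CriticalPhenomena-4575`); builds on
p205010 (kernel theorem, internal audit signed; external expert review pending). No definitions, no named facts, no
sorries; standard axioms. Pure real analysis (Mathlib only).

If `f_n → g` pointwise on a convex set `S ⊆ ℝ`, every `f_n` is concave on `S` and differentiable at `x ∈ S` with
`f_n'(x) → ℓ`, then the limit `g` is concave (`concaveOn_of_tendsto`) and its chords through `x` are sandwiched by `ℓ`:
`slope g x y ≤ ℓ` for `y > x` and `ℓ ≤ slope g y x` for `y < x` (`slope_le_of_tendsto_deriv`, `le_slope_of_tendsto_deriv`;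
Ellis 2006, Lemma IV.6.3: "`c_Λ'(t) → c'(t)` at every point of differentiability", here in the one-sided form that needs
no differentiability of the limit). Two elementary squeeze lemmas turn such sandwiches into one-sided and two-sided
derivatives (`hasDerivWithinAt_Ioi_of_slope_squeeze`, `hasDerivAt_of_slope_squeeze`).

## References

* R. S. Ellis, *Entropy, Large Deviations, and Statistical Mechanics*, Springer (1985/2006), Lemma IV.6.3 and the
  proofs of Lemma V.7.4 and Thm. V.7.2 (pp. 204–209). [Ellis2006]
* R. T. Rockafellar, *Convex Analysis*, Princeton (1970), Thm. 24.1 and Thm. 25.7. [Rockafellar1970]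
-/

noncomputable section

namespace Summit.CriticalPhenomena.PercolationContinuityZ3.Theorems.FK

namespace ConcaveLimit

open Filter Topology Set

/-- **A pointwise limit of concave functions is concave.** [cite: Rockafellar1970, Thm. 10.8; Ellis2006, Lemma IV.6.3] -/
theorem concaveOn_of_tendsto {S : Set ℝ} (hS : Convex ℝ S) {f : ℕ → ℝ → ℝ} {g : ℝ → ℝ}
    (hf : ∀ n, ConcaveOn ℝ S (f n)) (hlim : ∀ x ∈ S, Tendsto (fun n => f n x) atTop (𝓝 (g x))) :
    ConcaveOn ℝ S g := by
  refine ⟨hS, fun x hx y hy a b ha hb hab => ?_⟩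
  exact le_of_tendsto_of_tendsto' (((hlim x hx).const_smul a).add ((hlim y hy).const_smul b))
    (hlim _ (hS hx hy ha hb hab)) fun n => (hf n).2 hx hy ha hb hab

/-- Chords converge: `slope f_n x y → slope g x y`. [folklore] -/
theorem tendsto_slope_of_tendsto {S : Set ℝ} {f : ℕ → ℝ → ℝ} {g : ℝ → ℝ}
    (hlim : ∀ x ∈ S, Tendsto (fun n => f n x) atTop (𝓝 (g x))) {x y : ℝ} (hx : x ∈ S) (hy : y ∈ S) :
    Tendsto (fun n => slope (f n) x y) atTop (𝓝 (slope g x y)) := by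
  simp only [slope_def_field]
  exact ((hlim y hy).sub (hlim x hx)).div_const _

/-- **The slope sandwich, right side** (Ellis 2006, Lemma IV.6.3 in one-sided form): if `f_n → g` pointwise on the
convex set `S`, every `f_n` is concave on `S` and has derivative `f_n'(x)` at `x ∈ S` with `f_n'(x) → ℓ`, then
`slope g x y ≤ ℓ` for every `y ∈ S`, `y > x`. [cite: Ellis2006, Lemma IV.6.3; Rockafellar1970, Thm. 24.1] -/
theorem slope_le_of_tendsto_deriv {S : Set ℝ} {f : ℕ → ℝ → ℝ} {g : ℝ → ℝ} (hf : ∀ n, ConcaveOn ℝ S (f n))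
    (hlim : ∀ x ∈ S, Tendsto (fun n => f n x) atTop (𝓝 (g x))) {x : ℝ} (hx : x ∈ S) {f' : ℕ → ℝ} {ℓ : ℝ}
    (hder : ∀ n, HasDerivAt (f n) (f' n) x) (hf' : Tendsto f' atTop (𝓝 ℓ)) {y : ℝ} (hy : y ∈ S) (hxy : x < y) :
    slope g x y ≤ ℓ :=
  le_of_tendsto_of_tendsto' (tendsto_slope_of_tendsto hlim hx hy) hf' fun n =>
    (hf n).slope_le_of_hasDerivAt hx hy hxy (hder n)

/-- **The slope sandwich, left side**: under the same hypotheses, `ℓ ≤ slope g y x` for every `y ∈ S`, `y < x`.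
[cite: Ellis2006, Lemma IV.6.3; Rockafellar1970, Thm. 24.1] -/
theorem le_slope_of_tendsto_deriv {S : Set ℝ} {f : ℕ → ℝ → ℝ} {g : ℝ → ℝ} (hf : ∀ n, ConcaveOn ℝ S (f n))
    (hlim : ∀ x ∈ S, Tendsto (fun n => f n x) atTop (𝓝 (g x))) {x : ℝ} (hx : x ∈ S) {f' : ℕ → ℝ} {ℓ : ℝ}
    (hder : ∀ n, HasDerivAt (f n) (f' n) x) (hf' : Tendsto f' atTop (𝓝 ℓ)) {y : ℝ} (hy : y ∈ S) (hyx : y < x) :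
    ℓ ≤ slope g y x :=
  le_of_tendsto_of_tendsto' hf' (tendsto_slope_of_tendsto hlim hy hx) fun n =>
    (hf n).le_slope_of_hasDerivAt hy hx hyx (hder n)

/-- **Squeeze to a right derivative**: if the right chords of `g` at `x` satisfy `u y ≤ slope g x y ≤ ℓ` for `y ↓ x` and
`u y → ℓ`, then `g` has right derivative `ℓ` at `x`. [folklore] -/
theorem hasDerivWithinAt_Ioi_of_slope_squeeze {g u : ℝ → ℝ} {x ℓ : ℝ} (hup : ∀ᶠ y in 𝓝[>] x, slope g x y ≤ ℓ)
    (hlo : ∀ᶠ y in 𝓝[>] x, u y ≤ slope g x y) (hu : Tendsto u (𝓝[>] x) (𝓝 ℓ)) :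
    HasDerivWithinAt g ℓ (Ioi x) x := by
  rw [hasDerivWithinAt_iff_tendsto_slope, sdiff_singleton_eq_self fun h : x ∈ Ioi x => lt_irrefl x h]
  exact tendsto_of_tendsto_of_tendsto_of_le_of_le' hu tendsto_const_nhds hlo hup

/-- **Squeeze to a left derivative**: if the left chords satisfy `ℓ ≤ slope g y x ≤ u y` for `y ↑ x` and `u y → ℓ`,
then `g` has left derivative `ℓ` at `x`. [folklore] -/
theorem hasDerivWithinAt_Iio_of_slope_squeeze {g u : ℝ → ℝ} {x ℓ : ℝ} (hlo : ∀ᶠ y in 𝓝[<] x, ℓ ≤ slope g y x)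
    (hup : ∀ᶠ y in 𝓝[<] x, slope g y x ≤ u y) (hu : Tendsto u (𝓝[<] x) (𝓝 ℓ)) :
    HasDerivWithinAt g ℓ (Iio x) x := by
  rw [hasDerivWithinAt_iff_tendsto_slope, sdiff_singleton_eq_self fun h : x ∈ Iio x => lt_irrefl x h]
  refine tendsto_of_tendsto_of_tendsto_of_le_of_le' tendsto_const_nhds hu ?_ ?_
  · filter_upwards [hlo] with y hy; rwa [slope_comm]
  · filter_upwards [hup] with y hy; rwa [slope_comm]

/-- **Squeeze to a derivative**: the two one-sided squeezes together give `HasDerivAt g ℓ x`. [folklore] -/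
theorem hasDerivAt_of_slope_squeeze {g u v : ℝ → ℝ} {x ℓ : ℝ} (hup : ∀ᶠ y in 𝓝[>] x, slope g x y ≤ ℓ)
    (hlo : ∀ᶠ y in 𝓝[>] x, u y ≤ slope g x y) (hu : Tendsto u (𝓝[>] x) (𝓝 ℓ))
    (hlo' : ∀ᶠ y in 𝓝[<] x, ℓ ≤ slope g y x) (hup' : ∀ᶠ y in 𝓝[<] x, slope g y x ≤ v y)
    (hv : Tendsto v (𝓝[<] x) (𝓝 ℓ)) : HasDerivAt g ℓ x := by
  have hr := hasDerivWithinAt_Ioi_of_slope_squeeze hup hlo hu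
  have hl := hasDerivWithinAt_Iio_of_slope_squeeze hlo' hup' hv
  rw [hasDerivWithinAt_iff_tendsto_slope, sdiff_singleton_eq_self fun h : x ∈ Ioi x => lt_irrefl x h] at hr
  rw [hasDerivWithinAt_iff_tendsto_slope, sdiff_singleton_eq_self fun h : x ∈ Iio x => lt_irrefl x h] at hl
  rw [hasDerivAt_iff_tendsto_slope, ← nhdsLT_sup_nhdsGT]
  exact hl.sup hr

/-- **A right derivative is the only candidate for the derivative**: if `g` has right derivative `ℓ` at `x` and is
differentiable at `x`, then `deriv g x = ℓ`. [folklore] -/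
theorem deriv_eq_of_hasDerivWithinAt_Ioi {g : ℝ → ℝ} {x ℓ : ℝ} (hr : HasDerivWithinAt g ℓ (Ioi x) x)
    (hd : DifferentiableAt ℝ g x) : deriv g x = ℓ :=
  (uniqueDiffWithinAt_Ioi x).eq_deriv _ hd.hasDerivAt.hasDerivWithinAt hr

end ConcaveLimit

end Summit.CriticalPhenomena.PercolationContinuityZ3.Theorems.FK

end
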